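import Summits.BirchSwinnertonDyer.BirchSwinnertonDyer.Theorems.ByReductionTypeAtTwoFineSelmerConjAAtTwoAdditivePotGoodClassNumberOne780
import Summits.BirchSwinnertonDyer.BirchSwinnertonDyer.Theorems.ByReductionTypeAtTwoFineSelmerConjAAtTwoAdditivePotGoodTwoLayerDoorFukudaRows
import Summits.BirchSwinnertonDyer.BirchSwinnertonDyer.Theorems.ByReductionTypeAtTwoFineSelmerConjAAtTwoAdditivePotGoodTwoLayerStampsEvenIndexD
import Summits.BirchSwinnertonDyer.BirchSwinnertonDyer.Theorems.ByReductionTypeAtTwoOrdKatoHalfAtTwoIsoConjATwoCubicModelOfClassicalMu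
import Summits.BirchSwinnertonDyer.BirchSwinnertonDyer.Theorems.ByReductionTypeAtTwoOrdKatoHalfAtTwoIsoConjATwoOfNarrowRankCertificate
import HarnessLib

/-!
# K4 crux `AdditiveRankZeroAtTwo` (19098), child C3″ `AdditivePotGoodLowerHalfAtTwo` (item 22617): the TWO-PRIME `Δ_cubic > 0` rows — (A)₂ and the BSD₂ rungs with the
# print binder `hLim2` (LIM35@2-REAL) REPLACED by a NARROW RANK CERTIFICATE of the totally real cubic point field (census instance: ONE equality
# `rank₂ Cl⁺(ℚ(θ)·ℚ₁) = rank₂ Cl⁺(ℚ(θ))`; file C of the `NarrowRankRows` series A–C; seat `bsd-2adic-k4-w2` GEN 11; `--supports stmt-BirchSwinnertonDyer-22617 --as helper`)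

Cell `bsd-2adic`. After k4-w1 GEN 9's `conjA_two_100560c1''` (one prime above `2`: Horie–Fukuda unit-signature road, kernel) six `Δ_cubic > 0` rows of the C1″ census
still carried GEN 8's print binder `hLim2` = Lim 2017 Thm. 3.5 at `2` DOWNSTAIRS at a TOTALLY REAL carrier (the RC-457 D-audit risk `LIM35@2-REAL`): `261648q1`,
`279440c1`, `293200be1`, `412992bw1`, `445508b1`, `467928d1` — all with TWO primes above `2` in the cubic field `ℚ(θ)` (`h(ℚ(θ)) = 1`), outside the one-prime doors.
cruxlead-19573-w2 GEN 9 landed NARROW FUKUDA (Literature p739601 `NarrowFukudaRankProofs`, p739895 `NarrowFukudaCertificateLayerModels`: Fukuda 1994 Thm. 1 (2) for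
NARROW class groups, finite level) and the door `NarrowRankCert.conjA_two_cubicModel_of_narrowRankCertificate` (`…OrdKatoHalfAtTwoIsoConjATwoOfNarrowRankCertificate`, ANY
sign of `Δ`): Fukuda index `n₀` on the cubic tower ∧ `[Cl⁺(layer n₀+1) : (Cl⁺)²] = [Cl⁺(layer n₀) : (Cl⁺)²]` ∧ narrow ranks bounded below layer `n₀` ⟹ narrow `μ₂ = 0` and a
narrow-defect bound ⟹ (A)₂ by GEN 8's Kida-lite ascent `NarrowMu.conjA_two_cubicModel_of_narrowMu`. This file supplies, per row (rows `445508b1`, `467928d1`): §1 the KERNEL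
`n₀ = 0` on `ℚ(θ)` (`forall_totallyRamifiedFrom_zero_h<L>`: even-index certificates in `ℤ[θ]` (indices `7`, `3`: `2`-maximal) for `63644`, `51992`), the general stamp `AddKatoTwo.conjA_two_<L>_of_narrowRankCert hθ n B hcert` (exact change
`θ ↔ x(P)`; any layer pair `n / n+1`) and the CENSUS INSTANCE `AddKatoTwo.conjA_two_<L>_of_narrowRankEq₀₁ hθ hnr` — (A)₂ with NO print fact from ONE displayed equality of
narrow `2`-ranks at layers `0 / 1` (= equality of the unit-signature defects `#(U⁺/U²)` of `ℚ(θ, √2)` and `ℚ(θ)`, both class numbers being odd); §2 GEN 3's rungs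
re-keyed: `AddPotGoodInstances.bsdp_two_<L>_narrowRankEq`, `bsdp_two_of_isIsogenous_<L>_narrowRankEq` — BSD₂ on the class ⟸ PRINT {hSharp (reading), hGZK, hmod, hCT(,
hCassels)} + RECORD {r_an = 0, #Ш_an = q, ord₂ q ≤ 6} + the two VALUED Selmer slots + `hnr`; `hLim2` GONE. `θ` is k4-w1's generator (`…ChevalleyStamps{A,B,C}`).

HONEST FRAMING (D-0036 / D-0054 / D-0152): conditional theorems; `hnr` is an INSTRUMENT-tier datum that is **UNVALUED** when this file lands (the cell holds no
`bnfnarrow` record for these six cubic fields and their `√2`-layers; ≈ one core-minute of PARI owed — WANTED posted on STATUS; if the layer-`0/1` narrow ranks differ,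
the general stamp takes a higher layer pair); `hSharp` is the Kato-at-`2` SHARP reading (D-audit PASS). Closes nothing at the `∀`-level (C3″ 22617 / C1″ 22615 OPEN);
nothing booked (D-0054); no rung moves; BSD is not proved by any of this. THEOREMS ONLY (no `def`).

References: [Fukuda1994] Thm. 1 (2), p. 264; [Washington1997] §13.1 Prop. 13.2, Lemma 13.3; [Kida1982JFields] main theorem (shape); [CoatesSujatha2005] (A), Thm. 3.4;
[Kato2004Asterisque] Thm. 12.5 (1)(3), 13.8, 14.14; [Cassels1965ArithmeticVIII] Thm. 1.3; [Miller2011LMS] Def. 1.1.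
-/

set_option autoImplicit false
-- the Theorems namespace of this sub repeats the summit name by design (D-0017 nested layout)
set_option linter.dupNamespace false

noncomputable section

open scoped Classical IntermediateField NumberField Real nonZeroDivisors

/-! ## Kernel `n₀ = 0` and narrow-rank stamps (namespace `AddKatoTwo`); the rungs are in `…NarrowRankRungsC` -/

namespace Summit.BirchSwinnertonDyer.BirchSwinnertonDyer.Theorems.AddKatoTwo

open WeierstrassCurve Field Polynomial IsDedekindDomain NumberField Matrix Literature.NumberTheory.EllipticCurves
  Literature.NumberTheory.GaloisRepresentations
  Literature.NumberTheory.IwasawaTheory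
  Literature.NumberTheory.NumberFields
  Summit.BirchSwinnertonDyer.BirchSwinnertonDyer.Theorems.SteinbergFibreAtTwo
  Summit.BirchSwinnertonDyer.BirchSwinnertonDyer.Theorems.AlignedTransportAtTwoTorsionPointField
  Summit.BirchSwinnertonDyer.BirchSwinnertonDyer.Theses.ByReductionTypeAtTwo

/-- **A monic integer cubic with a root `β` of degree `3` is irreducible** (restated to keep this file's imports minimal). [folklore] -/
private theorem irreducibleCubic_of_finrank_three_srnrC {p q r : ℤ} {β : AlgebraicClosure ℚ}
    (hβ : aeval β (Cubic.toPoly ⟨1, (p : ℚ), q, r⟩) = 0) (h3 : Module.finrank ℚ (IntermediateField.adjoin ℚ {β}) = 3) :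
    Irreducible (Cubic.toPoly ⟨1, (p : ℚ), q, r⟩) := by
  have hfm : (Cubic.toPoly ⟨1, (p : ℚ), q, r⟩).Monic := Cubic.monic_of_a_eq_one'
  have hβint : IsIntegral ℚ β := ⟨_, hfm, by rwa [← aeval_def]⟩
  have hdeg : (minpoly ℚ β).natDegree = (Cubic.toPoly ⟨1, (p : ℚ), q, r⟩).natDegree := by
    rw [← IntermediateField.adjoin.finrank hβint, h3, Cubic.natDegree_of_a_ne_zero' one_ne_zero]
  have heq : Cubic.toPoly ⟨1, (p : ℚ), q, r⟩ = minpoly ℚ β :=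
    Polynomial.eq_of_monic_of_dvd_of_natDegree_le (minpoly.monic hβint) hfm (minpoly.dvd ℚ β hβ) hdeg.ge
  rw [heq]
  exact minpoly.irreducible hβint

/-- **The displayed part of the `n₀ = 0` narrow rank certificate from ONE layer-`0/1` equality, for any number field `K`** (file-private helper; the bound at layer `0` is
`ord₂ [Cl⁺(K) : (Cl⁺)²]` itself by `index_range_pow_narrowClassGroup_layer_zero_eq`). Stated for a generic `K` on purpose: at the concrete point fields
`ℚ(θ) ⊂ ℚ̄` the same `rw` exhausts the `isDefEq` budget. [cite: Fukuda1994, Thm. 1 (2), p. 264] -/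
private theorem narrowRankCert_zero_of_layerEq_C (K : Type) [Field K] [NumberField K]
    (hnr : ∀ κ : ZpExtension K 2, κ.IsCyclotomic →
      ∀ [NumberField ↥(κ.layer 0)] [NumberField ↥(κ.layer 1)],
        (powMonoidHom (α := NarrowClassGroup ↥(κ.layer 1)) 2).range.index =
          (powMonoidHom (α := NarrowClassGroup ↥(κ.layer 0)) 2).range.index) :
    ∀ κ : ZpExtension K 2, κ.IsCyclotomic →
      (∀ [NumberField ↥(κ.layer 0)] [NumberField ↥(κ.layer (0 + 1))],
        (powMonoidHom (α := NarrowClassGroup ↥(κ.layer (0 + 1))) 2).range.index =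
          (powMonoidHom (α := NarrowClassGroup ↥(κ.layer 0)) 2).range.index) ∧
      (∀ m : ℕ, m ≤ 0 → ∀ [NumberField ↥(κ.layer m)],
        padicValNat 2 (powMonoidHom (α := NarrowClassGroup ↥(κ.layer m)) 2).range.index ≤
          padicValNat 2 (powMonoidHom (α := NarrowClassGroup K) 2).range.index) := by
  intro κ hκ
  refine ⟨?_, ?_⟩
  · intro i0 i1
    exact @hnr κ hκ i0 i1
  · intro m hm i
    obtain rfl : m = 0 := Nat.le_zero.mp hm
    rw [index_range_pow_narrowClassGroup_layer_zero_eq κ 2]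

/-- **`n₀ = 0` for `ℚ(θ)` of `445508b1`, KERNEL, by an EVEN-INDEX CERTIFICATE** (k4-w1 p689647 `totallyRamifiedFrom_zero_of_evenIndexCertificate`):
`u = [-2, 0, 2]`, `v = [-2, 3, 1]`, `m = [-676, -139, 49]`, `m' = [-1286347, -210277, 105382]` (coordinates in `ℤ[θ]`, index `7` — `2`-maximal) satisfy `u² − 2v² = 4m`, `m² = 2m'`
and `N(2 − m'³) = -90602987115937214084287671967260215548683074204790` (`ord₂ = 1`, so `8 ∤`) — exact search (seat tools), verified as ring identities + one companion determinant.
[cite: Fukuda1994, p. 264 (the index `n₀`)] [cite: Washington1997, §13.1 Lemma 13.3 and Prop. 13.2] -/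
theorem forall_totallyRamifiedFrom_zero_h445508b1
    {θ : AlgebraicClosure ℚ} (hθ : aeval θ (Cubic.toPoly ⟨1, ((-1 : ℤ) : ℚ), ((-112 : ℤ) : ℚ), ((-270 : ℤ) : ℚ)⟩) = 0)
    :
    haveI : FiniteDimensional ℚ (IntermediateField.adjoin ℚ {θ}) :=
      IntermediateField.adjoin.finiteDimensional ((AlgebraicClosure.isAlgebraic ℚ).isAlgebraic θ).isIntegral
    haveI : NumberField (IntermediateField.adjoin ℚ {θ}) := NumberField.mk
    ∀ κL : ZpExtension (IntermediateField.adjoin ℚ {θ}) 2, κL.IsCyclotomic → TotallyRamifiedFrom κL 0 := by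
  haveI : FiniteDimensional ℚ (IntermediateField.adjoin ℚ {θ}) :=
    IntermediateField.adjoin.finiteDimensional ((AlgebraicClosure.isAlgebraic ℚ).isAlgebraic θ).isIntegral
  haveI : NumberField (IntermediateField.adjoin ℚ {θ}) := NumberField.mk
  have hirr := irreducible_cubic_d63644p
  have h3 := finrank_adjoin_eq_three_of_irreducible hirr hθ
  obtain ⟨B, -, hB⟩ := exists_ringOfIntegers_cubic_root (p := -1) (q := -112) (r := -270) hθ
  refine forall_totallyRamifiedFrom_zero_adjoin_of_evenIndexCertificate hirr hθ
    (((-2 : ℤ) : 𝓞 (IntermediateField.adjoin ℚ {θ})) + ((0 : ℤ) : 𝓞 (IntermediateField.adjoin ℚ {θ})) * B + ((2 : ℤ) : 𝓞 (IntermediateField.adjoin ℚ {θ})) * B ^ 2)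
    (((-2 : ℤ) : 𝓞 (IntermediateField.adjoin ℚ {θ})) + ((3 : ℤ) : 𝓞 (IntermediateField.adjoin ℚ {θ})) * B + ((1 : ℤ) : 𝓞 (IntermediateField.adjoin ℚ {θ})) * B ^ 2)
    (((-676 : ℤ) : 𝓞 (IntermediateField.adjoin ℚ {θ})) + ((-139 : ℤ) : 𝓞 (IntermediateField.adjoin ℚ {θ})) * B + ((49 : ℤ) : 𝓞 (IntermediateField.adjoin ℚ {θ})) * B ^ 2)
    (((-1286347 : ℤ) : 𝓞 (IntermediateField.adjoin ℚ {θ})) + ((-210277 : ℤ) : 𝓞 (IntermediateField.adjoin ℚ {θ})) * B + ((105382 : ℤ) : 𝓞 (IntermediateField.adjoin ℚ {θ})) * B ^ 2) ?_ ?_ ?_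
  · push_cast; linear_combination (((-10 : ℤ) : 𝓞 (IntermediateField.adjoin ℚ {θ})) + ((2 : ℤ) : 𝓞 (IntermediateField.adjoin ℚ {θ})) * B) * hB
  · push_cast; linear_combination (((-11221 : ℤ) : 𝓞 (IntermediateField.adjoin ℚ {θ})) + ((2401 : ℤ) : 𝓞 (IntermediateField.adjoin ℚ {θ})) * B) * hB
  · have hz : (2 : 𝓞 (IntermediateField.adjoin ℚ {θ})) - (((-1286347 : ℤ) : 𝓞 (IntermediateField.adjoin ℚ {θ})) + ((-210277 : ℤ) : 𝓞 (IntermediateField.adjoin ℚ {θ})) * B + ((105382 : ℤ) : 𝓞 (IntermediateField.adjoin ℚ {θ})) * B ^ 2) ^ 3 =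
        ((23587910571600162615 : ℤ) : 𝓞 (IntermediateField.adjoin ℚ {θ})) + (-16072153679684307557 : ℤ) * B + (-9489990831356124538 : ℤ) * B ^ 2 := by
      push_cast; linear_combination (((79479284627349847 : ℤ) : 𝓞 (IntermediateField.adjoin ℚ {θ})) + ((-96361712685020090 : ℤ) : 𝓞 (IntermediateField.adjoin ℚ {θ})) * B + ((5835303419399876 : ℤ) : 𝓞 (IntermediateField.adjoin ℚ {θ})) * B ^ 2 + ((-1170305671802968 : ℤ) : 𝓞 (IntermediateField.adjoin ℚ {θ})) * B ^ 3) * hB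
    rw [hz]
    exact not_eight_dvd_norm_coords _ h3 B hirr hB (23587910571600162615) (-16072153679684307557) (-9489990831356124538) (N := -90602987115937214084287671967260215548683074204790)
      (by simp only [Matrix.one_fin_three, Matrix.det_fin_three, Matrix.add_apply, Matrix.smul_apply, sq, Matrix.mul_apply,
        Fin.sum_univ_three, Matrix.of_apply, Matrix.cons_val', Matrix.cons_val_zero, Matrix.cons_val_one, Matrix.cons_val_two,
        Matrix.head_cons, Matrix.tail_cons, Matrix.empty_val', Matrix.cons_val_fin_one, smul_eq_mul]; norm_num) (by norm_num)

/-- **(A)₂ for `445508b1` from a NARROW RANK CERTIFICATE of the totally real cubic point field, NO print fact** (`d = 63644`, `2 = 𝔭²𝔮`, `h = 1` (kit F3(i) ranks 1 / 1 at layers 0/1, three primes above 2 there)): `θ` any root of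
`X³ + (-1)X² + (-112)X + (-270)` (`ℚ(P) = ℚ(β) = ℚ(θ)`, `β = x(P) = 5682 + (280)θ + (-77)θ²` a root of the `2`-division cubic — exact change of
generator); displayed, for a layer index `n` and a bound `B`: along every cyclotomic `ℤ₂`-extension of `ℚ(θ)`, `[Cl⁺(layer n+1) : (Cl⁺)²] = [Cl⁺(layer n) : (Cl⁺)²]`
and `ord₂ [Cl⁺(layer m) : (Cl⁺)²] ≤ B` for `m ≤ n` (narrow `2`-ranks; instrument). KERNEL: `n₀ = 0` on the cubic field (`forall_totallyRamifiedFrom_zero_h445508b1`,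
monotone to `n`), cruxlead-19573-w2's NARROW FUKUDA + Kida-lite ascent `NarrowRankCert.conjA_two_cubicModel_of_narrowRankCertificate` (any sign of `Δ`).
No `hLim2` (the LIM35@2-REAL print binder of GEN 8's `conjA_two_445508b1` is not used). BSD for `445508b1` is NOT proved by this.
[cite: Fukuda1994, Thm. 1 (2), p. 264] [cite: CoatesSujatha2005, Conj. A and Thm. 3.4] [cite: Kida1982JFields, main theorem (μ-part; shape only)] -/
theorem conjA_two_445508b1_of_narrowRankCert
    {θ : AlgebraicClosure ℚ} (hθ : aeval θ (Cubic.toPoly ⟨1, ((-1 : ℤ) : ℚ), ((-112 : ℤ) : ℚ), ((-270 : ℤ) : ℚ)⟩) = 0)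
    (n B : ℕ)
    (hcert : haveI : FiniteDimensional ℚ (IntermediateField.adjoin ℚ {θ}) :=
        IntermediateField.adjoin.finiteDimensional ((AlgebraicClosure.isAlgebraic ℚ).isAlgebraic θ).isIntegral
      haveI : NumberField (IntermediateField.adjoin ℚ {θ}) := NumberField.mk
      ∀ κL : ZpExtension (IntermediateField.adjoin ℚ {θ}) 2, κL.IsCyclotomic →
        (∀ [NumberField ↥(κL.layer n)] [NumberField ↥(κL.layer (n + 1))],
          (powMonoidHom (α := NarrowClassGroup ↥(κL.layer (n + 1))) 2).range.index =
            (powMonoidHom (α := NarrowClassGroup ↥(κL.layer n)) 2).range.index) ∧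
        (∀ m : ℕ, m ≤ n → ∀ [NumberField ↥(κL.layer m)],
          padicValNat 2 (powMonoidHom (α := NarrowClassGroup ↥(κL.layer m)) 2).range.index ≤ B))
    (κ : ZpExtension ℚ 2) (hκ : κ.IsCyclotomic) :
    haveI := (isElliptic_cubicModel _ _ _ (by simp only [Cubic.discr]; norm_num) : (⟨0, ((-1 : ℤ) : ℚ), 0, ((-14574772 : ℤ) : ℚ), ((-21411754440 : ℤ) : ℚ)⟩ : WeierstrassCurve ℚ).IsElliptic)
    ∃ (γ : absoluteGaloisGroup ℚ) (D : (⟨0, ((-1 : ℤ) : ℚ), 0, ((-14574772 : ℤ) : ℚ), ((-21411754440 : ℤ) : ℚ)⟩ : WeierstrassCurve ℚ).FineSelmerDualData κ γ),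
      Module.Finite ℤ_[2] (RestrictScalars ℤ_[2] (IwasawaAlgebra 2) D.X) := by
  haveI := (isElliptic_cubicModel _ _ _ (by simp only [Cubic.discr]; norm_num) : (⟨0, ((-1 : ℤ) : ℚ), 0, ((-14574772 : ℤ) : ℚ), ((-21411754440 : ℤ) : ℚ)⟩ : WeierstrassCurve ℚ).IsElliptic)
  have hθ' : θ ^ 3 + (-1 : AlgebraicClosure ℚ) * θ ^ 2 + (-112 : AlgebraicClosure ℚ) * θ + (-270 : AlgebraicClosure ℚ) = 0 := by
    have := hθ
    simp only [Cubic.toPoly, map_one, one_mul, aeval_add, aeval_mul, aeval_C, aeval_X_pow, aeval_X,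
      eq_ratCast, Rat.cast_intCast] at this
    push_cast at this
    linear_combination this
  obtain ⟨β, hβdef⟩ : ∃ β : AlgebraicClosure ℚ, β = algebraMap ℚ (AlgebraicClosure ℚ) (5682 : ℚ) +
      algebraMap ℚ (AlgebraicClosure ℚ) (280 : ℚ) * θ + algebraMap ℚ (AlgebraicClosure ℚ) (-77 : ℚ) * θ ^ 2 := ⟨_, rfl⟩
  have hβ : aeval β (Cubic.toPoly ⟨1, ((-1 : ℤ) : ℚ), ((-14574772 : ℤ) : ℚ), ((-21411754440 : ℤ) : ℚ)⟩) = 0 := by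
    simp only [Cubic.toPoly, map_one, one_mul, aeval_add, aeval_mul, aeval_C, aeval_X_pow, aeval_X, eq_ratCast,
      Rat.cast_intCast]
    rw [hβdef]
    simp only [eq_ratCast]
    push_cast
    linear_combination ((-293282150 : AlgebraicClosure ℚ) + (36341536 : AlgebraicClosure ℚ) * θ + (4523827 : AlgebraicClosure ℚ) * θ ^ 2 + (-456533 : AlgebraicClosure ℚ) * θ ^ 3) * hθ'
  have hadj : IntermediateField.adjoin ℚ {β} = IntermediateField.adjoin ℚ {θ} := by
    apply le_antisymm
    · rw [IntermediateField.adjoin_simple_le_iff, hβdef]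
      have hθmem := IntermediateField.mem_adjoin_simple_self ℚ θ
      exact add_mem (add_mem (algebraMap_mem _ _) (mul_mem (algebraMap_mem _ _) hθmem))
        (mul_mem (algebraMap_mem _ _) (pow_mem hθmem 2))
    · rw [IntermediateField.adjoin_simple_le_iff]
      have hθeq : θ = algebraMap ℚ (AlgebraicClosure ℚ) (-53436774 / 49 : ℚ) +
          algebraMap ℚ (AlgebraicClosure ℚ) (-24253 / 98 : ℚ) * β +
          algebraMap ℚ (AlgebraicClosure ℚ) (11 / 98 : ℚ) * β ^ 2 := by
        rw [hβdef]; simp only [eq_ratCast]; push_cast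
        linear_combination (((8349 : AlgebraicClosure ℚ) / 2) + ((-1331 : AlgebraicClosure ℚ) / 2) * θ) * hθ'
      rw [hθeq]
      have hβmem := IntermediateField.mem_adjoin_simple_self ℚ β
      exact add_mem (add_mem (algebraMap_mem _ _) (mul_mem (algebraMap_mem _ _) hβmem))
        (mul_mem (algebraMap_mem _ _) (pow_mem hβmem 2))
  haveI : FiniteDimensional ℚ (IntermediateField.adjoin ℚ {θ}) :=
    IntermediateField.adjoin.finiteDimensional ((AlgebraicClosure.isAlgebraic ℚ).isAlgebraic θ).isIntegral
  haveI : NumberField (IntermediateField.adjoin ℚ {θ}) := NumberField.mk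
  have h3 := finrank_adjoin_eq_three_of_irreducible irreducible_cubic_d63644p hθ
  have h3β : Module.finrank ℚ (IntermediateField.adjoin ℚ {β}) = 3 := by rw [hadj]; exact h3
  -- transport along `ℚ(β) = ℚ(θ)` by substituting a field VARIABLE (a `rw` on this statement times out at `whnf`)
  have hcert' : ∀ F : IntermediateField ℚ (AlgebraicClosure ℚ), IntermediateField.adjoin ℚ {θ} = F →
      ∀ κL : ZpExtension ↥F 2, κL.IsCyclotomic →
      TotallyRamifiedFrom κL n ∧
      (∀ [NumberField ↥(κL.layer n)] [NumberField ↥(κL.layer (n + 1))],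
        (powMonoidHom (α := NarrowClassGroup ↥(κL.layer (n + 1))) 2).range.index =
          (powMonoidHom (α := NarrowClassGroup ↥(κL.layer n)) 2).range.index) ∧
      (∀ m : ℕ, m ≤ n → ∀ [NumberField ↥(κL.layer m)],
        padicValNat 2 (powMonoidHom (α := NarrowClassGroup ↥(κL.layer m)) 2).range.index ≤ B) :=
    by rintro F rfl; exact fun κL hκL => ⟨(forall_totallyRamifiedFrom_zero_h445508b1 hθ κL hκL).mono (Nat.zero_le n), hcert κL hκL⟩
  exact NarrowRankCert.conjA_two_cubicModel_of_narrowRankCertificate (-1) (-14574772) (-21411754440)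
    (irreducibleCubic_of_finrank_three_srnrC hβ h3β) hβ n B (hcert' _ hadj.symm) κ hκ

/-- **(A)₂ for `445508b1` WITHOUT any print fact — the CENSUS INSTANCE: ONE displayed equality of narrow `2`-ranks at layers `0 / 1`**, i.e.
`rank₂ Cl⁺(ℚ(θ)·ℚ₁) = rank₂ Cl⁺(ℚ(θ))` (`ℚ(θ)·ℚ₁ = ℚ(θ, √2)`, degrees `6` and `3`; for these `h`-odd fields = equality of the unit-signature defects
`#(U⁺/U²)` at the two layers) — instrument tier, **UNVALUED at landing time** (no `bnfnarrow` record in the cell for this field; kit owed). `n = 0`, `B = ord₂ [Cl⁺(ℚ(θ)) : (Cl⁺)²]`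
in `conjA_two_445508b1_of_narrowRankCert` (the layer-`0` bound is automatic by `index_range_pow_narrowClassGroup_layer_zero_eq`). Replaces the print binder `hLim2`
(LIM35@2-REAL) of GEN 8's road on this row. BSD for `445508b1` is NOT proved by this. [cite: Fukuda1994, Thm. 1 (2), p. 264] [cite: Washington1997, §13.1]
[cite: CoatesSujatha2005, Conj. A and Thm. 3.4] -/
theorem conjA_two_445508b1_of_narrowRankEq₀₁
    {θ : AlgebraicClosure ℚ} (hθ : aeval θ (Cubic.toPoly ⟨1, ((-1 : ℤ) : ℚ), ((-112 : ℤ) : ℚ), ((-270 : ℤ) : ℚ)⟩) = 0)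
    (hnr : haveI : FiniteDimensional ℚ (IntermediateField.adjoin ℚ {θ}) :=
        IntermediateField.adjoin.finiteDimensional ((AlgebraicClosure.isAlgebraic ℚ).isAlgebraic θ).isIntegral
      haveI : NumberField (IntermediateField.adjoin ℚ {θ}) := NumberField.mk
      ∀ κL : ZpExtension (IntermediateField.adjoin ℚ {θ}) 2, κL.IsCyclotomic →
        ∀ [NumberField ↥(κL.layer 0)] [NumberField ↥(κL.layer 1)],
          (powMonoidHom (α := NarrowClassGroup ↥(κL.layer 1)) 2).range.index =
            (powMonoidHom (α := NarrowClassGroup ↥(κL.layer 0)) 2).range.index)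
    (κ : ZpExtension ℚ 2) (hκ : κ.IsCyclotomic) :
    haveI := (isElliptic_cubicModel _ _ _ (by simp only [Cubic.discr]; norm_num) : (⟨0, ((-1 : ℤ) : ℚ), 0, ((-14574772 : ℤ) : ℚ), ((-21411754440 : ℤ) : ℚ)⟩ : WeierstrassCurve ℚ).IsElliptic)
    ∃ (γ : absoluteGaloisGroup ℚ) (D : (⟨0, ((-1 : ℤ) : ℚ), 0, ((-14574772 : ℤ) : ℚ), ((-21411754440 : ℤ) : ℚ)⟩ : WeierstrassCurve ℚ).FineSelmerDualData κ γ),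
      Module.Finite ℤ_[2] (RestrictScalars ℤ_[2] (IwasawaAlgebra 2) D.X) := by
  haveI : FiniteDimensional ℚ (IntermediateField.adjoin ℚ {θ}) :=
    IntermediateField.adjoin.finiteDimensional ((AlgebraicClosure.isAlgebraic ℚ).isAlgebraic θ).isIntegral
  haveI : NumberField (IntermediateField.adjoin ℚ {θ}) := NumberField.mk
  exact conjA_two_445508b1_of_narrowRankCert hθ 0 _
    (narrowRankCert_zero_of_layerEq_C _ hnr) κ hκ

/-- **`n₀ = 0` for `ℚ(θ)` of `467928d1`, KERNEL, by an EVEN-INDEX CERTIFICATE** (k4-w1 p689647 `totallyRamifiedFrom_zero_of_evenIndexCertificate`):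
`u = [0, -1, -3]`, `v = [-3, -3, -2]`, `m = [-1458, -357, 11]`, `m' = [-259461, 146814, 49991]` (coordinates in `ℤ[θ]`, index `3` — `2`-maximal) satisfy `u² − 2v² = 4m`, `m² = 2m'`
and `N(2 − m'³) = -47630228183861456617179041146159071640954516526357982` (`ord₂ = 1`, so `8 ∤`) — exact search (seat tools), verified as ring identities + one companion determinant.
[cite: Fukuda1994, p. 264 (the index `n₀`)] [cite: Washington1997, §13.1 Lemma 13.3 and Prop. 13.2] -/
theorem forall_totallyRamifiedFrom_zero_h467928d1
    {θ : AlgebraicClosure ℚ} (hθ : aeval θ (Cubic.toPoly ⟨1, ((-1 : ℤ) : ℚ), ((-102 : ℤ) : ℚ), ((-342 : ℤ) : ℚ)⟩) = 0)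
    :
    haveI : FiniteDimensional ℚ (IntermediateField.adjoin ℚ {θ}) :=
      IntermediateField.adjoin.finiteDimensional ((AlgebraicClosure.isAlgebraic ℚ).isAlgebraic θ).isIntegral
    haveI : NumberField (IntermediateField.adjoin ℚ {θ}) := NumberField.mk
    ∀ κL : ZpExtension (IntermediateField.adjoin ℚ {θ}) 2, κL.IsCyclotomic → TotallyRamifiedFrom κL 0 := by
  haveI : FiniteDimensional ℚ (IntermediateField.adjoin ℚ {θ}) :=
    IntermediateField.adjoin.finiteDimensional ((AlgebraicClosure.isAlgebraic ℚ).isAlgebraic θ).isIntegral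
  haveI : NumberField (IntermediateField.adjoin ℚ {θ}) := NumberField.mk
  have hirr := irreducible_cubic_d51992p
  have h3 := finrank_adjoin_eq_three_of_irreducible hirr hθ
  obtain ⟨B, -, hB⟩ := exists_ringOfIntegers_cubic_root (p := -1) (q := -102) (r := -342) hθ
  refine forall_totallyRamifiedFrom_zero_adjoin_of_evenIndexCertificate hirr hθ
    (((0 : ℤ) : 𝓞 (IntermediateField.adjoin ℚ {θ})) + ((-1 : ℤ) : 𝓞 (IntermediateField.adjoin ℚ {θ})) * B + ((-3 : ℤ) : 𝓞 (IntermediateField.adjoin ℚ {θ})) * B ^ 2)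
    (((-3 : ℤ) : 𝓞 (IntermediateField.adjoin ℚ {θ})) + ((-3 : ℤ) : 𝓞 (IntermediateField.adjoin ℚ {θ})) * B + ((-2 : ℤ) : 𝓞 (IntermediateField.adjoin ℚ {θ})) * B ^ 2)
    (((-1458 : ℤ) : 𝓞 (IntermediateField.adjoin ℚ {θ})) + ((-357 : ℤ) : 𝓞 (IntermediateField.adjoin ℚ {θ})) * B + ((11 : ℤ) : 𝓞 (IntermediateField.adjoin ℚ {θ})) * B ^ 2)
    (((-259461 : ℤ) : 𝓞 (IntermediateField.adjoin ℚ {θ})) + ((146814 : ℤ) : 𝓞 (IntermediateField.adjoin ℚ {θ})) * B + ((49991 : ℤ) : 𝓞 (IntermediateField.adjoin ℚ {θ})) * B ^ 2) ?_ ?_ ?_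
  · push_cast; linear_combination (((-17 : ℤ) : 𝓞 (IntermediateField.adjoin ℚ {θ})) + ((1 : ℤ) : 𝓞 (IntermediateField.adjoin ℚ {θ})) * B) * hB
  · push_cast; linear_combination (((-7733 : ℤ) : 𝓞 (IntermediateField.adjoin ℚ {θ})) + ((121 : ℤ) : 𝓞 (IntermediateField.adjoin ℚ {θ})) * B) * hB
  · have hz : (2 : 𝓞 (IntermediateField.adjoin ℚ {θ})) - (((-259461 : ℤ) : 𝓞 (IntermediateField.adjoin ℚ {θ})) + ((146814 : ℤ) : 𝓞 (IntermediateField.adjoin ℚ {θ})) * B + ((49991 : ℤ) : 𝓞 (IntermediateField.adjoin ℚ {θ})) * B ^ 2) ^ 3 =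
        ((-59742646145478723913 : ℤ) : 𝓞 (IntermediateField.adjoin ℚ {θ})) + (-23070418454823397458 : ℤ) * B + (-2143344331133742419 : ℤ) * B ^ 2 := by
      push_cast; linear_combination (((-174737172698036588 : ℤ) : 𝓞 (IntermediateField.adjoin ℚ {θ})) + ((-15256070992835600 : ℤ) : 𝓞 (IntermediateField.adjoin ℚ {θ})) * B + ((-1225641150025073 : ℤ) : 𝓞 (IntermediateField.adjoin ℚ {θ})) * B ^ 2 + ((-124932512149271 : ℤ) : 𝓞 (IntermediateField.adjoin ℚ {θ})) * B ^ 3) * hB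
    rw [hz]
    exact not_eight_dvd_norm_coords _ h3 B hirr hB (-59742646145478723913) (-23070418454823397458) (-2143344331133742419) (N := -47630228183861456617179041146159071640954516526357982)
      (by simp only [Matrix.one_fin_three, Matrix.det_fin_three, Matrix.add_apply, Matrix.smul_apply, sq, Matrix.mul_apply,
        Fin.sum_univ_three, Matrix.of_apply, Matrix.cons_val', Matrix.cons_val_zero, Matrix.cons_val_one, Matrix.cons_val_two,
        Matrix.head_cons, Matrix.tail_cons, Matrix.empty_val', Matrix.cons_val_fin_one, smul_eq_mul]; norm_num) (by norm_num)

/-- **(A)₂ for `467928d1` from a NARROW RANK CERTIFICATE of the totally real cubic point field, NO print fact** (`d = 51992`, `2 = 𝔭𝔮²`, `h = 1`): `θ` any root of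
`X³ + (-1)X² + (-102)X + (-342)` (`ℚ(P) = ℚ(β) = ℚ(θ)`, `β = x(P) = -10555 + (1120)θ + (149)θ²` a root of the `2`-division cubic — exact change of
generator); displayed, for a layer index `n` and a bound `B`: along every cyclotomic `ℤ₂`-extension of `ℚ(θ)`, `[Cl⁺(layer n+1) : (Cl⁺)²] = [Cl⁺(layer n) : (Cl⁺)²]`
and `ord₂ [Cl⁺(layer m) : (Cl⁺)²] ≤ B` for `m ≤ n` (narrow `2`-ranks; instrument). KERNEL: `n₀ = 0` on the cubic field (`forall_totallyRamifiedFrom_zero_h467928d1`,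
monotone to `n`), cruxlead-19573-w2's NARROW FUKUDA + Kida-lite ascent `NarrowRankCert.conjA_two_cubicModel_of_narrowRankCertificate` (any sign of `Δ`).
No `hLim2` (the LIM35@2-REAL print binder of GEN 8's `conjA_two_467928d1` is not used). BSD for `467928d1` is NOT proved by this.
[cite: Fukuda1994, Thm. 1 (2), p. 264] [cite: CoatesSujatha2005, Conj. A and Thm. 3.4] [cite: Kida1982JFields, main theorem (μ-part; shape only)] -/
theorem conjA_two_467928d1_of_narrowRankCert
    {θ : AlgebraicClosure ℚ} (hθ : aeval θ (Cubic.toPoly ⟨1, ((-1 : ℤ) : ℚ), ((-102 : ℤ) : ℚ), ((-342 : ℤ) : ℚ)⟩) = 0)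
    (n B : ℕ)
    (hcert : haveI : FiniteDimensional ℚ (IntermediateField.adjoin ℚ {θ}) :=
        IntermediateField.adjoin.finiteDimensional ((AlgebraicClosure.isAlgebraic ℚ).isAlgebraic θ).isIntegral
      haveI : NumberField (IntermediateField.adjoin ℚ {θ}) := NumberField.mk
      ∀ κL : ZpExtension (IntermediateField.adjoin ℚ {θ}) 2, κL.IsCyclotomic →
        (∀ [NumberField ↥(κL.layer n)] [NumberField ↥(κL.layer (n + 1))],
          (powMonoidHom (α := NarrowClassGroup ↥(κL.layer (n + 1))) 2).range.index =
            (powMonoidHom (α := NarrowClassGroup ↥(κL.layer n)) 2).range.index) ∧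
        (∀ m : ℕ, m ≤ n → ∀ [NumberField ↥(κL.layer m)],
          padicValNat 2 (powMonoidHom (α := NarrowClassGroup ↥(κL.layer m)) 2).range.index ≤ B))
    (κ : ZpExtension ℚ 2) (hκ : κ.IsCyclotomic) :
    haveI := (isElliptic_cubicModel _ _ _ (by simp only [Cubic.discr]; norm_num) : (⟨0, ((0 : ℤ) : ℚ), 0, ((-434619795 : ℤ) : ℚ), ((-3475423424306 : ℤ) : ℚ)⟩ : WeierstrassCurve ℚ).IsElliptic)
    ∃ (γ : absoluteGaloisGroup ℚ) (D : (⟨0, ((0 : ℤ) : ℚ), 0, ((-434619795 : ℤ) : ℚ), ((-3475423424306 : ℤ) : ℚ)⟩ : WeierstrassCurve ℚ).FineSelmerDualData κ γ),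
      Module.Finite ℤ_[2] (RestrictScalars ℤ_[2] (IwasawaAlgebra 2) D.X) := by
  haveI := (isElliptic_cubicModel _ _ _ (by simp only [Cubic.discr]; norm_num) : (⟨0, ((0 : ℤ) : ℚ), 0, ((-434619795 : ℤ) : ℚ), ((-3475423424306 : ℤ) : ℚ)⟩ : WeierstrassCurve ℚ).IsElliptic)
  have hθ' : θ ^ 3 + (-1 : AlgebraicClosure ℚ) * θ ^ 2 + (-102 : AlgebraicClosure ℚ) * θ + (-342 : AlgebraicClosure ℚ) = 0 := by
    have := hθ
    simp only [Cubic.toPoly, map_one, one_mul, aeval_add, aeval_mul, aeval_C, aeval_X_pow, aeval_X,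
      eq_ratCast, Rat.cast_intCast] at this
    push_cast at this
    linear_combination this
  obtain ⟨β, hβdef⟩ : ∃ β : AlgebraicClosure ℚ, β = algebraMap ℚ (AlgebraicClosure ℚ) (-10555 : ℚ) +
      algebraMap ℚ (AlgebraicClosure ℚ) (1120 : ℚ) * θ + algebraMap ℚ (AlgebraicClosure ℚ) (149 : ℚ) * θ ^ 2 := ⟨_, rfl⟩
  have hβ : aeval β (Cubic.toPoly ⟨1, ((0 : ℤ) : ℚ), ((-434619795 : ℤ) : ℚ), ((-3475423424306 : ℤ) : ℚ)⟩) = 0 := by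
    simp only [Cubic.toPoly, map_one, one_mul, aeval_add, aeval_mul, aeval_C, aeval_X_pow, aeval_X, eq_ratCast,
      Rat.cast_intCast]
    rw [hβdef]
    simp only [eq_ratCast]
    push_cast
    linear_combination ((186909918 : AlgebraicClosure ℚ) + (273036242 : AlgebraicClosure ℚ) * θ + (77903309 : AlgebraicClosure ℚ) * θ ^ 2 + (3307949 : AlgebraicClosure ℚ) * θ ^ 3) * hθ'
  have hadj : IntermediateField.adjoin ℚ {β} = IntermediateField.adjoin ℚ {θ} := by
    apply le_antisymm
    · rw [IntermediateField.adjoin_simple_le_iff, hβdef]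
      have hθmem := IntermediateField.mem_adjoin_simple_self ℚ θ
      exact add_mem (add_mem (algebraMap_mem _ _) (mul_mem (algebraMap_mem _ _) hθmem))
        (mul_mem (algebraMap_mem _ _) (pow_mem hθmem 2))
    · rw [IntermediateField.adjoin_simple_le_iff]
      have hθeq : θ = algebraMap ℚ (AlgebraicClosure ℚ) (-21219221939 / 1100683638 : ℚ) +
          algebraMap ℚ (AlgebraicClosure ℚ) (-729473 / 2201367276 : ℚ) * β +
          algebraMap ℚ (AlgebraicClosure ℚ) (149 / 2201367276 : ℚ) * β ^ 2 := by
        rw [hβdef]; simp only [eq_ratCast]; push_cast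
        linear_combination (((-53038189 : AlgebraicClosure ℚ) / 2201367276) + ((-3307949 : AlgebraicClosure ℚ) / 2201367276) * θ) * hθ'
      rw [hθeq]
      have hβmem := IntermediateField.mem_adjoin_simple_self ℚ β
      exact add_mem (add_mem (algebraMap_mem _ _) (mul_mem (algebraMap_mem _ _) hβmem))
        (mul_mem (algebraMap_mem _ _) (pow_mem hβmem 2))
  haveI : FiniteDimensional ℚ (IntermediateField.adjoin ℚ {θ}) :=
    IntermediateField.adjoin.finiteDimensional ((AlgebraicClosure.isAlgebraic ℚ).isAlgebraic θ).isIntegral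
  haveI : NumberField (IntermediateField.adjoin ℚ {θ}) := NumberField.mk
  have h3 := finrank_adjoin_eq_three_of_irreducible irreducible_cubic_d51992p hθ
  have h3β : Module.finrank ℚ (IntermediateField.adjoin ℚ {β}) = 3 := by rw [hadj]; exact h3
  -- transport along `ℚ(β) = ℚ(θ)` by substituting a field VARIABLE (a `rw` on this statement times out at `whnf`)
  have hcert' : ∀ F : IntermediateField ℚ (AlgebraicClosure ℚ), IntermediateField.adjoin ℚ {θ} = F →
      ∀ κL : ZpExtension ↥F 2, κL.IsCyclotomic →
      TotallyRamifiedFrom κL n ∧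
      (∀ [NumberField ↥(κL.layer n)] [NumberField ↥(κL.layer (n + 1))],
        (powMonoidHom (α := NarrowClassGroup ↥(κL.layer (n + 1))) 2).range.index =
          (powMonoidHom (α := NarrowClassGroup ↥(κL.layer n)) 2).range.index) ∧
      (∀ m : ℕ, m ≤ n → ∀ [NumberField ↥(κL.layer m)],
        padicValNat 2 (powMonoidHom (α := NarrowClassGroup ↥(κL.layer m)) 2).range.index ≤ B) :=
    by rintro F rfl; exact fun κL hκL => ⟨(forall_totallyRamifiedFrom_zero_h467928d1 hθ κL hκL).mono (Nat.zero_le n), hcert κL hκL⟩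
  exact NarrowRankCert.conjA_two_cubicModel_of_narrowRankCertificate (0) (-434619795) (-3475423424306)
    (irreducibleCubic_of_finrank_three_srnrC hβ h3β) hβ n B (hcert' _ hadj.symm) κ hκ

/-- **(A)₂ for `467928d1` WITHOUT any print fact — the CENSUS INSTANCE: ONE displayed equality of narrow `2`-ranks at layers `0 / 1`**, i.e.
`rank₂ Cl⁺(ℚ(θ)·ℚ₁) = rank₂ Cl⁺(ℚ(θ))` (`ℚ(θ)·ℚ₁ = ℚ(θ, √2)`, degrees `6` and `3`; for these `h`-odd fields = equality of the unit-signature defects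
`#(U⁺/U²)` at the two layers) — instrument tier, **UNVALUED at landing time** (no `bnfnarrow` record in the cell for this field; kit owed). `n = 0`, `B = ord₂ [Cl⁺(ℚ(θ)) : (Cl⁺)²]`
in `conjA_two_467928d1_of_narrowRankCert` (the layer-`0` bound is automatic by `index_range_pow_narrowClassGroup_layer_zero_eq`). Replaces the print binder `hLim2`
(LIM35@2-REAL) of GEN 8's road on this row. BSD for `467928d1` is NOT proved by this. [cite: Fukuda1994, Thm. 1 (2), p. 264] [cite: Washington1997, §13.1]
[cite: CoatesSujatha2005, Conj. A and Thm. 3.4] -/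
theorem conjA_two_467928d1_of_narrowRankEq₀₁
    {θ : AlgebraicClosure ℚ} (hθ : aeval θ (Cubic.toPoly ⟨1, ((-1 : ℤ) : ℚ), ((-102 : ℤ) : ℚ), ((-342 : ℤ) : ℚ)⟩) = 0)
    (hnr : haveI : FiniteDimensional ℚ (IntermediateField.adjoin ℚ {θ}) :=
        IntermediateField.adjoin.finiteDimensional ((AlgebraicClosure.isAlgebraic ℚ).isAlgebraic θ).isIntegral
      haveI : NumberField (IntermediateField.adjoin ℚ {θ}) := NumberField.mk
      ∀ κL : ZpExtension (IntermediateField.adjoin ℚ {θ}) 2, κL.IsCyclotomic →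
        ∀ [NumberField ↥(κL.layer 0)] [NumberField ↥(κL.layer 1)],
          (powMonoidHom (α := NarrowClassGroup ↥(κL.layer 1)) 2).range.index =
            (powMonoidHom (α := NarrowClassGroup ↥(κL.layer 0)) 2).range.index)
    (κ : ZpExtension ℚ 2) (hκ : κ.IsCyclotomic) :
    haveI := (isElliptic_cubicModel _ _ _ (by simp only [Cubic.discr]; norm_num) : (⟨0, ((0 : ℤ) : ℚ), 0, ((-434619795 : ℤ) : ℚ), ((-3475423424306 : ℤ) : ℚ)⟩ : WeierstrassCurve ℚ).IsElliptic)
    ∃ (γ : absoluteGaloisGroup ℚ) (D : (⟨0, ((0 : ℤ) : ℚ), 0, ((-434619795 : ℤ) : ℚ), ((-3475423424306 : ℤ) : ℚ)⟩ : WeierstrassCurve ℚ).FineSelmerDualData κ γ),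
      Module.Finite ℤ_[2] (RestrictScalars ℤ_[2] (IwasawaAlgebra 2) D.X) := by
  haveI : FiniteDimensional ℚ (IntermediateField.adjoin ℚ {θ}) :=
    IntermediateField.adjoin.finiteDimensional ((AlgebraicClosure.isAlgebraic ℚ).isAlgebraic θ).isIntegral
  haveI : NumberField (IntermediateField.adjoin ℚ {θ}) := NumberField.mk
  exact conjA_two_467928d1_of_narrowRankCert hθ 0 _
    (narrowRankCert_zero_of_layerEq_C _ hnr) κ hκ

end Summit.BirchSwinnertonDyer.BirchSwinnertonDyer.Theorems.AddKatoTwo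

end
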